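import Summits.QuantumFields.YangMills.Theorems.BalabanUVNodesN16EntrySqueezeJunction
import Summits.QuantumFields.YangMills.Theorems.BalabanUVNodesN16Stage3OfFamilyMat
import Summits.QuantumFields.YangMills.Theorems.BalabanUVNodesN16PinnedLayer13CoPHAx

/-!
# Route «BalabanUVNodes», crux K3ᴬ `SpineGivenEndpointR13SepCoPHVAx` (stmt-QuantumFields-27247), node N16 = NE3 — THE TOP KNIT, PART (B2) READING-FREE:
# module 59b's (β16) producer from node N16's chain-entry object `hE` + node N07's Reg910 slot key, with its N16 row stated AT RR-1's LOOSE OBJECT OF RECORD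
# (no reading, no Stage-13 tuple, no centre) — so that BOTH reading towers (the CoPH tower of K3⁸ and the centre-map ∕ Ax tower of K3ᴬ v8) read it in one line each

Cell `pub-ymgap`, seat `pub-ymgap-dag-n16-e` (R134 acceleration seat (a), strategy s2 = BY-NAME KNIT at the record; HUMAN RULING D-0062; chair R424 venue), generation 31,
module 62 (THEOREMS ONLY, 0 `def`, 0 `sorry`, standard axioms; Theses-free, importable).  `--kind proof --supports stmt-QuantumFields-27247 --as helper` (count-neutral;
proves NO registered stub).  `bears_on: R4∕N16 · edges N05 → N16, N07 → N16`.  Over module 59b `…N16EntrySqueezeJunction` (✓p689699), module 58 `…N16Stage3OfFamilyMat`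
(✓p688784) and R12 `…N16PinnedLayer13CoPHAx` (✓p805490).

WHY (this seat's LOCATED «N16's K3 share is CENTRE-BLIND», pub-ymgap INBOX l.21677; plan g100 K3ᴬ v8 b38fad1764a2d455 REGISTERED 2026-08-31T04:29Z).  The registered stub
`K3Skeleton13SepCoPHAxV8.stub_rates13HV` reads node N16's guard rows and rates conjunct over the Ax reading tower `RateReading₁₃CoPHAx 2` (T1-core ✓p805119), while every
landed N16 producer (modules 43 §4 ∕ 45 ∕ 53 ∕ 59b ∕ 59g ∕ 61) states its N16 row at CoPH READINGS, `∀ 𝔯 : RateReading₁₃CoPH N, N16PinnedLoose 𝔯 ℓ₃ B → N16HolderAtReading 𝔯 β`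
— a sentence that reads the Stage-13 provisos only as the inhabitation premise `(∃ θ, θ.Provisos₁₃CoPH F N) →` (module 43 `n16HolderAtReading_iff_of_pinnedLoose`) and hence
does NOT transfer to the re-centred tower by a lemma (no tree map takes `∃ θ, θ.Provisos₁₃CoPHAx F N` to it).  But every such producer PROVES the reading-free row first
(59b :150–152: THE END's regime re-lettered, the print-slot closer at radius `ε ∕ B₃`, antitonicity down to `ε ∕ B`) and only then wraps it in a reading.  THIS MODULE states
module 59b §2 with that wrapper removed — §1 ★★ `exists_letters_n16HolderAt_looseLayer_squeezeJunction_of_entry_reg910Slot`: the SAME letters `ℓ₃ B c'`, the SAME eight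
conjuncts, the fifth now `∀ F, N16HolderAt (ne3OfRecord₁₁ F {RR-1's constant layer read by ℓ₃ F, data cut at (ℓ₃ F).ε ∕ B F}) β` (proof = 59b's VERBATIM minus one line) —
and §2 reads it back at EITHER tower in one line: `n16HolderAtReading_of_looseLayer` (CoPH, module 43 — recovers 59b §2's row) ∕ `n16HolderAtReadingCmap_of_looseLayer`
(EVERY centre map `Χ`, R12 — the K3ᴬ v8 row).  §3 is the same producer in node N05's Σ-object currency (`hN05` at `stage3OfFamilyMat F N`, module 58's bridge).

HONEST FRAMING.  Bookkeeping BY NAME; no estimate; one landed proof re-run with its last wrapper removed.  `hE` ([Balaban1985RegularSpaces] Thm 4 p. 88 with Prop. 3's letters,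
Hölder member at exponent `β` AS PRINTED, all-torus geometry, every depth, ONE threshold) ∕ `hN05` (node N05's Σ-object — N05∕N06 content) and the SLOT KEY (node N07 —
[Balaban1985Variational] Thm 1 (9)–(10): `G hGm hG C hR`) are DISPLAYED HYPOTHESES asserted for no family; no stub of K3ᴬ v8 (or of the ASIDE K3⁸ v7) is closed or claimed;
**N16 ∕ N05 ∕ N06 ∕ N07 NOT discharged**; counts UNMOVED (typed 28∕28 · discharged 8∕27 · A 8∕28 — the chair's line is the only count).  One finite four-torus at fixed `ε`,
Bałaban AS PRINTED — NOT ℝ⁴, NOT infinite volume, NOT OS, NOT a mass gap; the Yang–Mills mass gap (Clay) is NOT proved by any of this.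
References: [Balaban1985RegularSpaces] T. Bałaban, CMP **99** (1985) 75–102, Thm 4 p. 88, Prop. 3 p. 87; [Balaban1985Variational] T. Bałaban, CMP **102** (1985) 277–309, Thm 1 p. 279.
-/

set_option autoImplicit false

open scoped BigOperators Matrix Matrix.Norms.L2Operator
open NormedSpace

namespace Summit.QuantumFields.YangMills.BalabanUVNodes.N16EntrySqueezeJunctionReadingFree

open Literature.MathematicalPhysics.QuantumFieldTheory.Balaban1983to89
open Literature.MathematicalPhysics.QuantumFieldTheory.Balaban1983to89.T4Continuum (T4Family ULoop)
open B7Prop1Explicit B7Prop2Explicit MatrixLog UnitaryModel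
open T4AveragingDeficitWall hiding Site Plane Plaq Bond
open B7Eq92Concrete (mgauge)
open B8Ineq132 (covDerivFwd)
open B8Eq184Proof (cfgExp)
open B8Eq119TwistedAxial (Restr129)
open B8Eq138LandauZd (covLap IsLandau138)
open B8Thm4TorusAt (torusLam Thm4TorusAt)
open B8LeafModelZdHP2Per (zdGF3HP₂Per)
open Node00 (Stage13Params Stage13HParams ChiSlot IdxB8SubDPerκ NE3Objects₁₁ NE3Letters₁₁ ne3ConstLayerOfRecord₁₁ ne3NperOfRecord₁₁ ne3DomOfRecord₁₁
  one_le_ne3NperOfRecord₁₁ MatA)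
open Summit.QuantumFields.BalabanUV.T4Continuum
open MinimalActionSandwich (IsMinimiser admissible)
open MinimalActionLevels (levelAction)
open MinimalActionRate (sfClass)
open MinimalActionRefine (RegularSup gradConst)
open MinimalActionDictionary (torusVP RadiiMono)
open NE3.LeafIndexSockets (LeafH3sup)
open AveragingDeficitLatticeH2Prep (fd)
open B11 (Regularity)
open YMDAG.UVSplit (ne3OfRecord₁₁ RateReading₁₃CoPH rateCarriersOfRecord₁₃CoPH RateReading₁₃CoPHCmap RateReading₁₃CoPHAx rateCarriersOfRecord₁₃CoPHCmap)
open Summit.QuantumFields.YangMills.BalabanUVNodes.N16HolderDefs (N16HolderAt)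
open Summit.QuantumFields.YangMills.BalabanUVNodes.N16HolderRegime (PrintSlotHolder InEndRegimeH radiusOfRecordH constOfRecordH n16HolderAt_of_inEndRegimeH_printSlotHolder)
open Summit.QuantumFields.YangMills.BalabanUVNodes.N16H7LooseOfReg910Slot (leafH3sup_loose_of_reg910Slot)
open Summit.QuantumFields.YangMills.BalabanUVNodes.N16PinnedLayer13CoPH (N16PinnedLoose N16LettersEnd N16HolderAtReading n16HolderAtReading_of_pinnedLoose
  N16PinnedLooseCmap N16PinnedLooseAx N16HolderAtReadingCmap N16HolderAtReadingAx n16HolderAtReadingCmap_of_pinnedLoose)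
open Summit.QuantumFields.YangMills.BalabanUVNodes.N16PinnedLooseMatch (n16HolderAt_anti_dom looseDom_anti)
open Summit.QuantumFields.YangMills.BalabanUVNodes.N16 (gradConst_four_pos)
open Summit.QuantumFields.YangMills.BalabanUVNodes.N16PinnedLooseMatchSqueeze (inEndRegimeH_reletter squeezeLetters_spec)
open Summit.QuantumFields.YangMills.BalabanUVNodes.N16PinnedLooseMatchSqueezeJunction (junctionRows_of_lowerBounds)
open Summit.QuantumFields.YangMills.BalabanUVNodes.N16EntrySqueezeClassRadius (printSlotHolder_reletter exists_letters_inEndRegimeH_printSlotHolder_classRadius_of_entry_reg910Slot)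
open Summit.QuantumFields.YangMills.BalabanUVNodes.N16Stage3OfFamilyMat (stage3OfFamilyMat exists_entry_of_n05UniformP)

noncomputable section

variable {N : ℕ} [NeZero N] {β : ℝ}

/-! ## §1 ★★ Module 59b §2's producer with its N16 row READING-FREE -/

section Producer

variable (hβ1 : β ≤ 1)
include hβ1

/-- **★★ THE (β16) PRODUCER WITH NODE N19′'s N16-LETTER BLOCK AND THE JUNCTION ROWS — N16 ROW READING-FREE.**  Module 59b §2
`exists_letters_n16HolderAtReading_loose_squeezeJunction_of_entry_reg910Slot` VERBATIM (hypotheses `hE`, `G hGm hG C hR`, `β ≤ 1`; letters `ℓ₃`, sup letter `c'`, enlarged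
radius letter `B`; conjuncts: THE END's letter rows at `g := gradConst 4 ∘ c'` · the radius MATCH row · the two `B`-floor rows · node N19′'s ten-row letter block · **the N16
conjunct `N16HolderAt (ne3OfRecord₁₁ F {RR-1's constant layer of record read by ℓ₃ F with its data CUT at radius (ℓ₃ F).ε ∕ B F}) β` FOR EVERY FAMILY `F`** (59b: the same
sentence wrapped as «every CoPH reading pinned loose at `(ℓ₃, B)` satisfies `N16HolderAtReading · β`») · the loose leaf at `ρ F := (C F).B₃·((ℓ₃ F).ε ∕ B F)` · the six
junction scalar rows).  Proof = 59b's, the reading wrapper `n16HolderAtReading_of_pinnedLoose` dropped. [cite: Balaban1985Variational, Thm 1 (9)–(10) p.279] [folklore] -/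
theorem exists_letters_n16HolderAt_looseLayer_squeezeJunction_of_entry_reg910Slot
    (hE : ∀ F : T4Family, ∃ B Bh c₁' : ℝ, 0 < B ∧ 0 < c₁' ∧ 16 * (B * c₁') ≤ 1 ∧
      ∀ k, 1 ≤ k → Thm4TorusAt F.L k (((ne3NperOfRecord₁₁ F 0 0 * F.L ^ k : ℕ) : ℤ)) (((F.L : ℝ) ^ k)⁻¹) c₁' (unitaryUnits (Matrix (Fin N) (Fin N) ℂ))
        (fun _ => True) (Restr129 F.L k (torusLam k))
        (fun (α₀ α₁ : ℝ) (U₀ U' : Site 4 → Fin 4 → (Matrix (Fin N) (Fin N) ℂ)ˣ) (u : Site 4 → (Matrix (Fin N) (Fin N) ℂ)ˣ) =>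
          ∃ A : Site 4 → Fin 4 → Matrix (Fin N) (Fin N) ℂ,
            (∀ x μ, IsSelfAdjoint (A x μ)) ∧ (∀ (x : Site 4) (κ μ : Fin 4), A (x + (((ne3NperOfRecord₁₁ F 0 0 * F.L ^ k : ℕ) : ℤ)) • e κ) μ = A x μ) ∧
            mgauge U₀ u (cfgExp (((F.L : ℝ) ^ k)⁻¹) A) = U' ∧
            (∀ x μ, ‖A x μ‖ ≤ B * (α₀ + α₁)) ∧
            (∀ (μ : Fin 4) (x : Site 4) (κ : Fin 4), ‖covDerivFwd (((F.L : ℝ) ^ k)⁻¹) U₀ μ (fun z => A z κ) x‖ ≤ B * (α₀ + α₁)) ∧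
            IsLandau138 F.L k (((F.L : ℝ) ^ k)⁻¹) Set.univ (torusLam k) U₀ A ∧
            (∀ (μ : Fin 4) (y : Site 4) (κ : Fin 4),
              ‖Ad (U₀ y μ) (covDerivFwd (((F.L : ℝ) ^ k)⁻¹) U₀ μ (fun z => A z κ) (y + e μ)) - covDerivFwd (((F.L : ℝ) ^ k)⁻¹) U₀ μ (fun z => A z κ) y‖
                ≤ Bh * (α₀ + α₁) * (((F.L : ℝ)⁻¹) ^ k) ^ β) ∧
            (∀ (x : Site 4) (κ : Fin 4), ‖covLap (((F.L : ℝ) ^ k)⁻¹) U₀ (fun z => A z κ) x‖ ≤ B * (α₀ + α₁))))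
    {G : T4Family → (Site 4 → Fin 4 → (MatA N)ˣ) → Site 4 → ℕ → ℝ → ℝ → ℝ → Prop} (hGm : ∀ F, RadiiMono 4 (G F))
    (hG : ∀ (F : T4Family) (U : Site 4 → Fin 4 → (MatA N)ˣ) (x : Site 4) (K : ℕ) (α₀ α₁ α₂ : ℝ), 2 ≤ K → G F U x K α₀ α₁ α₂ →
      ∃ (u : Site 4 → (MatA N)ˣ) (a : Site 4 → Fin 4 → MatA N),
        (∀ z, u z ∈ unitaryUnits (MatA N)) ∧
        (∀ (y : Site 4) (τ : Fin 4), l1 (y - x) ≤ 2 → ((gaugeAct u U y τ : (MatA N)ˣ) : MatA N) = exp (a y τ)) ∧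
        (∀ (y : Site 4) (τ : Fin 4), l1 (y - x) ≤ 2 → ‖a y τ‖ ≤ α₀) ∧
        (∀ (y : Site 4) (τ i : Fin 4), l1 (y - x) ≤ 1 → ‖fd i (fun z => a z τ) y‖ ≤ α₁) ∧
        (∀ (τ i l : Fin 4), ‖fd i (fd l (fun z => a z τ)) x‖ ≤ α₂))
    (C : T4Family → B11Thm1.Consts)
    (hR : ∀ (F : T4Family) (k : ℕ) (ε₁ : ℝ), 0 < ε₁ → ε₁ ≤ (C F).a₁ → ∀ (V U : Site 4 → Fin 4 → (MatA N)ˣ), V ∈ sfClass 4 F.L (ne3NperOfRecord₁₁ F 0 0) ε₁ 0 →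
      IsMinimiser 4 (sfClass 4 F.L (ne3NperOfRecord₁₁ F 0 0) ((C F).B₃ * ε₁)) F.L (ne3NperOfRecord₁₁ F 0 0) (k + 1) V U →
        ∀ x : Site 4, Regularity (torusVP 4 F.L (ne3NperOfRecord₁₁ F 0 0) (G F) (k + 1)) (C F).B₃ (C F).B₄ ε₁ U (x, F.L ^ (k + 1) - 1 + F.L ^ (k + 1) + 2)) :
    ∃ (ℓ₃ : T4Family → NE3Letters₁₁) (B c' : T4Family → ℝ), N16LettersEnd N (fun F => gradConst 4 (c' F)) ℓ₃ ∧
      (∀ F : T4Family, 0 < B F ∧ (ℓ₃ F).ε / B F ≤ (ℓ₃ F).b) ∧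
      (∀ F : T4Family, (C F).B₃ ≤ B F ∧ (2 : ℝ) ^ 78 * (F.L : ℝ) ^ 12 ≤ B F) ∧
      (∀ F : T4Family, (ℓ₃ F).g = gradConst 4 (c' F) ∧ 0 ≤ c' F ∧ 0 < c' F ∧ (ℓ₃ F).b ≤ c' F ∧
        (2 : ℝ) ^ 91 * (F.L : ℝ) ^ 17 * c' F ≤ 1 ∧ (2 : ℝ) ^ 76 * (F.L : ℝ) ^ 12 * c' F ≤ (ℓ₃ F).ε ∧
        16 * C0 4 * (ℓ₃ F).ε ≤ 3 ∧ 1024 * (4 + 1) * (4 + 4) * (F.L : ℝ) ^ 2 * (ℓ₃ F).ε ≤ 1 ∧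
        (ℓ₃ F).ε / B F ≤ 1 / 4 ∧ 4 * ((ℓ₃ F).ε / B F) ≤ c' F) ∧
      (∀ F : T4Family, N16HolderAt (ne3OfRecord₁₁ F { ne3ConstLayerOfRecord₁₁ F N (ℓ₃ F) with
        dom := {V | V ∈ ne3DomOfRecord₁₁ F N 0 0 ∧ V ∈ sfClass 4 F.L (ne3NperOfRecord₁₁ F 0 0) ((ℓ₃ F).ε / B F) 0} }) β) ∧
      (∀ F : T4Family, LeafH3sup 4 F.L (ne3NperOfRecord₁₁ F 0 0) ((C F).B₃ * ((ℓ₃ F).ε / B F)) ((C F).B₃ * ((ℓ₃ F).ε / B F))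
        (16937 * ((C F).B₃ * ((ℓ₃ F).ε / B F)))
        ({V | V ∈ ne3DomOfRecord₁₁ F N 0 0 ∧ V ∈ sfClass 4 F.L (ne3NperOfRecord₁₁ F 0 0) ((ℓ₃ F).ε / B F) 0} : Set (Site 4 → Fin 4 → (MatA N)ˣ))) ∧
      (∀ F : T4Family, 0 < (C F).B₃ * ((ℓ₃ F).ε / B F) ∧ (C F).B₃ * ((ℓ₃ F).ε / B F) ≤ (ℓ₃ F).ε ∧
        (C F).B₃ * ((ℓ₃ F).ε / B F) ≤ (ℓ₃ F).b ∧ 16937 * ((C F).B₃ * ((ℓ₃ F).ε / B F)) ≤ c' F ∧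
        (C F).B₃ * ((ℓ₃ F).ε / B F) ≤ (C F).B₃ * (C F).a₁ ∧ (C F).B₃ * ((ℓ₃ F).ε / B F) ≤ 1 / 28) := by
  -- the letters of record at the loose object of radius `ε ∕ B₃`, from `hE` and the slot key, at the auxiliary coupling letter `1`, with the class-radius rows (module 50 §2)
  choose ℓ hℓ using fun F => exists_letters_inEndRegimeH_printSlotHolder_classRadius_of_entry_reg910Slot (N := N) F one_pos (hE F) (hGm F) (hG F) (C F) (hR F)
  have hε0 : ∀ F, 0 < (ℓ F).ε := fun F => (hℓ F).2.2.2.2.2.2.2.2.1.2.2.2.1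
  have hL1 : ∀ F : T4Family, (1 : ℝ) ≤ F.L := fun F => by exact_mod_cast le_trans one_le_two (HistoryFlow.two_le_L F)
  have hL1n : ∀ F : T4Family, 1 ≤ F.L := fun F => le_trans one_le_two (HistoryFlow.two_le_L F)
  -- the squeezed sup letter per family (module 49) and the ENLARGED radius letter
  obtain ⟨c'f, hc'f⟩ : ∃ c'f : T4Family → ℝ, c'f = fun F => min ((ℓ F).ε / ((2 : ℝ) ^ 76 * (F.L : ℝ) ^ 12)) (1 / ((2 : ℝ) ^ 91 * (F.L : ℝ) ^ 17)) := ⟨_, rfl⟩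
  have hs : ∀ F, 0 < c'f F ∧ (2 : ℝ) ^ 91 * (F.L : ℝ) ^ 17 * c'f F ≤ 1 ∧ (2 : ℝ) ^ 76 * (F.L : ℝ) ^ 12 * c'f F ≤ (ℓ F).ε ∧ c'f F ≤ (ℓ F).ε / 2 ∧
      512 * (4 + 1) * (4 + 4) * (F.L : ℝ) ^ 2 * c'f F ≤ 1 := fun F => by
    subst hc'f
    obtain ⟨h1, h2, h3, h4, h5', -⟩ := squeezeLetters_spec (hL1 F) (hε0 F) (C F).B₃_pos
    exact ⟨h1, h2, h3, h4, h5'⟩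
  obtain ⟨Bf, hBf⟩ : ∃ Bf : T4Family → ℝ, Bf = fun F => max (max (C F).B₃ (4 * (ℓ F).ε / c'f F))
      (max (16937 * (C F).B₃ * (ℓ F).ε / c'f F) (max ((ℓ F).ε / (C F).a₁) (28 * (C F).B₃ * (ℓ F).ε))) := ⟨_, rfl⟩
  have hJ : ∀ F, (0 < Bf F ∧ (C F).B₃ ≤ Bf F ∧ (ℓ F).ε / Bf F ≤ c'f F ∧ (ℓ F).ε / Bf F ≤ 1 / 4 ∧ 4 * ((ℓ F).ε / Bf F) ≤ c'f F ∧
      (2 : ℝ) ^ 78 * (F.L : ℝ) ^ 12 ≤ Bf F) ∧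
      (0 < (C F).B₃ * ((ℓ F).ε / Bf F) ∧ (C F).B₃ * ((ℓ F).ε / Bf F) ≤ (ℓ F).ε ∧ (C F).B₃ * ((ℓ F).ε / Bf F) ≤ c'f F ∧
        16937 * ((C F).B₃ * ((ℓ F).ε / Bf F)) ≤ c'f F ∧ (C F).B₃ * ((ℓ F).ε / Bf F) ≤ (C F).B₃ * (C F).a₁ ∧ (C F).B₃ * ((ℓ F).ε / Bf F) ≤ 1 / 28) := fun F => by
    subst hBf
    exact junctionRows_of_lowerBounds (hL1 F) (hε0 F) (C F).B₃_pos (C F).a₁_pos (hs F).1 (hs F).2.1 (hs F).2.2.1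
      (le_max_of_le_left (le_max_left _ _)) (le_max_of_le_left (le_max_right _ _)) (le_max_of_le_right (le_max_left _ _))
      (le_max_of_le_right (le_max_of_le_right (le_max_left _ _))) (le_max_of_le_right (le_max_of_le_right (le_max_right _ _)))
  -- the loose leaf from the slot key at `ρ := B₃·(ε∕B)` (its data cut `ρ∕B₃` is the pinned loose radius `ε∕B`)
  have hleaf : ∀ F : T4Family, LeafH3sup 4 F.L (ne3NperOfRecord₁₁ F 0 0) ((C F).B₃ * ((ℓ F).ε / Bf F)) ((C F).B₃ * ((ℓ F).ε / Bf F))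
      (16937 * ((C F).B₃ * ((ℓ F).ε / Bf F)))
      ({V | V ∈ ne3DomOfRecord₁₁ F N 0 0 ∧ V ∈ sfClass 4 F.L (ne3NperOfRecord₁₁ F 0 0) ((ℓ F).ε / Bf F) 0} : Set (Site 4 → Fin 4 → (MatA N)ˣ)) := fun F => by
    have hl := leafH3sup_loose_of_reg910Slot (hL1n F) (hGm F) (hG F) (C F) (hR F) (hJ F).2.1 (hJ F).2.2.2.2.2.1 (hJ F).2.2.2.2.2.2
      (ne3DomOfRecord₁₁ F N 0 0)
    rwa [mul_div_cancel_left₀ _ (C F).B₃_pos.ne'] at hl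
  refine ⟨fun F => ⟨(ℓ F).ε, c'f F, gradConst 4 (c'f F), constOfRecordH N F.L (ne3NperOfRecord₁₁ F 0 0) (gradConst 4 (c'f F)), (ℓ F).Λ₁, (ℓ F).Λ₂'⟩, Bf, c'f,
    fun F => ⟨rfl, (hℓ F).2.1, rfl, (hs F).1, (hs F).2.2.2.2, (hℓ F).2.2.2.2.2.1, ?_⟩,
    fun F => ⟨(hJ F).1.1, (hJ F).1.2.2.1⟩, fun F => ⟨(hJ F).1.2.1, (hJ F).1.2.2.2.2.2⟩,
    fun F => ⟨rfl, (hs F).1.le, (hs F).1, le_rfl, (hs F).2.1, (hs F).2.2.1, (hℓ F).2.2.2.2.2.2.1, (hℓ F).2.2.2.2.2.2.2.1,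
      (hJ F).1.2.2.2.1, (hJ F).1.2.2.2.2.1⟩,
    fun F => ?_, hleaf,
    fun F => ⟨(hJ F).2.1, (hJ F).2.2.1, (hJ F).2.2.2.1, (hJ F).2.2.2.2.1, (hJ F).2.2.2.2.2.1, (hJ F).2.2.2.2.2.2⟩⟩
  · -- THE END's regime at the re-lettered constant layer (module 49 §1 transport of module 50 §2's `InEndRegimeH`; the regime does not read the data)
    have hreg := inEndRegimeH_reletter F _ (ne3DomOfRecord₁₁ F N 0 0) (hℓ F).2.2.2.2.2.2.2.2.1 (gradConst_four_pos (hs F).1) (hs F).1.le (hs F).2.2.2.1 le_rfl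
    exact hreg
  · -- the N16 conjunct: closer at radius `ε ∕ B₃` on the re-lettered loose object, then antitonicity down to radius `ε ∕ B`
    have hreg := inEndRegimeH_reletter F _ {V | V ∈ ne3DomOfRecord₁₁ F N 0 0 ∧ V ∈ sfClass 4 F.L (ne3NperOfRecord₁₁ F 0 0) ((ℓ F).ε / (C F).B₃) 0}
      (hℓ F).2.2.2.2.2.2.2.2.1 (gradConst_four_pos (hs F).1) (hs F).1.le (hs F).2.2.2.1 le_rfl
    have hH := n16HolderAt_of_inEndRegimeH_printSlotHolder hreg hβ1 (printSlotHolder_reletter F _ _ _ _ (hℓ F).2.2.2.2.2.2.2.2.2)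
    have hres := n16HolderAt_anti_dom F (looseDom_anti F (hε0 F).le (C F).B₃_pos (hJ F).1.2.1) hH
    exact hres

end Producer

/-! ## §2 Either reading tower reads the reading-free row in one line -/

/-- **THE CoPH TOWER** (K3⁸'s): every reading `𝔯 : RateReading₁₃CoPH N` pinned loose at `(ℓ₃, B)` satisfies N16's conjunct at every Stage-13 tuple with core provisos and every
run length — module 43 `n16HolderAtReading_of_pinnedLoose` BY NAME (recovers module 59b §2's fifth conjunct from §1's). [folklore] -/
theorem n16HolderAtReading_of_looseLayer {ℓ₃ : T4Family → NE3Letters₁₁} {B : T4Family → ℝ}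
    (H : ∀ F : T4Family, N16HolderAt (ne3OfRecord₁₁ F { ne3ConstLayerOfRecord₁₁ F N (ℓ₃ F) with
      dom := {V | V ∈ ne3DomOfRecord₁₁ F N 0 0 ∧ V ∈ sfClass 4 F.L (ne3NperOfRecord₁₁ F 0 0) ((ℓ₃ F).ε / B F) 0} }) β)
    (𝔯 : RateReading₁₃CoPH N) (hpin : N16PinnedLoose 𝔯 ℓ₃ B) : N16HolderAtReading 𝔯 β :=
  n16HolderAtReading_of_pinnedLoose β hpin H

/-- **THE CENTRE-MAP-GENERIC TOWER** (K3ᴬ v8's at `Χ := chiβOfRecord₁₃Ax`): every reading `𝔯 : RateReading₁₃CoPHCmap N Χ` pinned loose at `(ℓ₃, B)` satisfies N16's conjunct at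
every Stage-13 tuple with χ-provisos and every run length — R12 `n16HolderAtReadingCmap_of_pinnedLoose` BY NAME. [folklore] -/
theorem n16HolderAtReadingCmap_of_looseLayer {Χ : (F : T4Family) → Stage13Params F N → ChiSlot F N} {ℓ₃ : T4Family → NE3Letters₁₁} {B : T4Family → ℝ}
    (H : ∀ F : T4Family, N16HolderAt (ne3OfRecord₁₁ F { ne3ConstLayerOfRecord₁₁ F N (ℓ₃ F) with
      dom := {V | V ∈ ne3DomOfRecord₁₁ F N 0 0 ∧ V ∈ sfClass 4 F.L (ne3NperOfRecord₁₁ F 0 0) ((ℓ₃ F).ε / B F) 0} }) β)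
    (𝔯 : RateReading₁₃CoPHCmap N Χ) (hpin : N16PinnedLooseCmap 𝔯 ℓ₃ B) : N16HolderAtReadingCmap 𝔯 β :=
  n16HolderAtReadingCmap_of_pinnedLoose β hpin H

/-- … in particular at THE Ax READING OF RECORD (`RateReading₁₃CoPHAx N`, binder `θ.Provisos₁₃CoPHAx F N`): the unfolded row the stub-1 closer's rates face consumes,
`N16HolderAt (rateCarriersOfRecord₁₃CoPHCmap 𝔯 F θ hP g₀ os k).ne3 β` at every tuple and run length. [folklore] -/
theorem n16HolderAt_rateCarriersAx_of_looseLayer {ℓ₃ : T4Family → NE3Letters₁₁} {B : T4Family → ℝ}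
    (H : ∀ F : T4Family, N16HolderAt (ne3OfRecord₁₁ F { ne3ConstLayerOfRecord₁₁ F N (ℓ₃ F) with
      dom := {V | V ∈ ne3DomOfRecord₁₁ F N 0 0 ∧ V ∈ sfClass 4 F.L (ne3NperOfRecord₁₁ F 0 0) ((ℓ₃ F).ε / B F) 0} }) β)
    (𝔯 : RateReading₁₃CoPHAx N) (hpin : N16PinnedLooseAx 𝔯 ℓ₃ B) (F : T4Family) (θ : Stage13HParams F N) (hP : θ.Provisos₁₃CoPHAx F N) (g₀ : ℕ → ℝ)
    (os : List (ULoop F)) (k : ℕ) : N16HolderAt (rateCarriersOfRecord₁₃CoPHCmap 𝔯 F θ hP g₀ os k).ne3 β :=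
  n16HolderAtReadingCmap_of_pinnedLoose β hpin H F θ hP g₀ os k

/-! ## §3 ★★ The same producer in node N05's Σ-object currency (module 58's bridge `hN05 → hE`) -/

/-- **★★ THE READING-FREE PRODUCER FROM NODE N05's Σ-OBJECT AND THE SLOT KEY** (`0 ≤ β ≤ 1`): `hN05` = p681888's CONCLUSION TEXT at `θ := stage3OfFamilyMat F N` (period family
`ν ↦ ne3NperOfRecord₁₁ F 0 0 · F.L^ν`, pins `(Mκ, Rκ)` and the Hölder length letter existential per family — module 59g's binder at general `N`) and the slot key give the letters
`ℓ₃ g B` with THE END's rows, the radius MATCH row and the reading-free N16 row (§1's conjuncts 1, 2, 5 — the three the K3 guard and rates face read; module 58 §2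
`exists_entry_of_n05UniformP` ∘ §1). [cite: Balaban1985RegularSpaces, Thm 4 p.88, Prop. 3 p.87] [folklore] -/
theorem exists_letters_n16HolderAt_looseLayer_of_n05UniformP_reg910Slot (hβ0 : 0 ≤ β) (hβ1 : β ≤ 1)
    (hN05 : ∀ F : T4Family, letI : CStarAlgebra (Matrix (Fin N) (Fin N) ℂ) := B10Eq29TubeLine.cstarAlgebraMatrix N
      ∃ (Mκ Rκ : ℕ) (len : Site 4 → ℝ), (∀ v : Site 4, 0 < len v → 1 ≤ len v) ∧ (∀ μ : Fin 4, len (e μ) = 1) ∧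
      ∃ (inp : B8.B9Inputs) (B₀β B₈ c₄ c₃ : ℝ), inp.B₀ ≤ B₈ ∧ 0 < c₄ ∧ 0 < c₃ ∧
        ∀ (ν : {k : ℕ // 1 ≤ k}) (a : IdxB8SubDPerκ (stage3OfFamilyMat F N) (ne3NperOfRecord₁₁ F 0 0 * F.L ^ ν.1) Mκ Rκ),
          B8.Thm4Body c₄ (5 * ((4 : ℕ) : ℝ) * F.L * B₈)
            (fun _ : Unit => (zdGF3HP₂Per (Matrix (Fin N) (Fin N) ℂ) F.L β len a.toZdIdx (ne3NperOfRecord₁₁ F 0 0 * F.L ^ ν.1)).toGFData) ∧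
          B8.Prop3Body c₃ 4 (F.L : ℝ) (2097152 * (((4 : ℕ) : ℝ) + 1) ^ 2 * (F.L : ℝ) ^ 2) inp B₀β
            (fun _ : Unit => (zdGF3HP₂Per (Matrix (Fin N) (Fin N) ℂ) F.L β len a.toZdIdx (ne3NperOfRecord₁₁ F 0 0 * F.L ^ ν.1)).toGFData2))
    {G : T4Family → (Site 4 → Fin 4 → (MatA N)ˣ) → Site 4 → ℕ → ℝ → ℝ → ℝ → Prop} (hGm : ∀ F, RadiiMono 4 (G F))
    (hG : ∀ (F : T4Family) (U : Site 4 → Fin 4 → (MatA N)ˣ) (x : Site 4) (K : ℕ) (α₀ α₁ α₂ : ℝ), 2 ≤ K → G F U x K α₀ α₁ α₂ →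
      ∃ (u : Site 4 → (MatA N)ˣ) (a : Site 4 → Fin 4 → MatA N),
        (∀ z, u z ∈ unitaryUnits (MatA N)) ∧
        (∀ (y : Site 4) (τ : Fin 4), l1 (y - x) ≤ 2 → ((gaugeAct u U y τ : (MatA N)ˣ) : MatA N) = exp (a y τ)) ∧
        (∀ (y : Site 4) (τ : Fin 4), l1 (y - x) ≤ 2 → ‖a y τ‖ ≤ α₀) ∧
        (∀ (y : Site 4) (τ i : Fin 4), l1 (y - x) ≤ 1 → ‖fd i (fun z => a z τ) y‖ ≤ α₁) ∧
        (∀ (τ i l : Fin 4), ‖fd i (fd l (fun z => a z τ)) x‖ ≤ α₂))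
    (C : T4Family → B11Thm1.Consts)
    (hR : ∀ (F : T4Family) (k : ℕ) (ε₁ : ℝ), 0 < ε₁ → ε₁ ≤ (C F).a₁ → ∀ (V U : Site 4 → Fin 4 → (MatA N)ˣ), V ∈ sfClass 4 F.L (ne3NperOfRecord₁₁ F 0 0) ε₁ 0 →
      IsMinimiser 4 (sfClass 4 F.L (ne3NperOfRecord₁₁ F 0 0) ((C F).B₃ * ε₁)) F.L (ne3NperOfRecord₁₁ F 0 0) (k + 1) V U →
        ∀ x : Site 4, Regularity (torusVP 4 F.L (ne3NperOfRecord₁₁ F 0 0) (G F) (k + 1)) (C F).B₃ (C F).B₄ ε₁ U (x, F.L ^ (k + 1) - 1 + F.L ^ (k + 1) + 2)) :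
    ∃ (ℓ₃ : T4Family → NE3Letters₁₁) (g B : T4Family → ℝ), N16LettersEnd N g ℓ₃ ∧ (∀ F : T4Family, 0 < B F ∧ (ℓ₃ F).ε / B F ≤ (ℓ₃ F).b) ∧
      ∀ F : T4Family, N16HolderAt (ne3OfRecord₁₁ F { ne3ConstLayerOfRecord₁₁ F N (ℓ₃ F) with
      dom := {V | V ∈ ne3DomOfRecord₁₁ F N 0 0 ∧ V ∈ sfClass 4 F.L (ne3NperOfRecord₁₁ F 0 0) ((ℓ₃ F).ε / B F) 0} }) β := by
  obtain ⟨ℓ₃, B, c', hend, hmatch, -, -, hrow, -⟩ :=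
    exists_letters_n16HolderAt_looseLayer_squeezeJunction_of_entry_reg910Slot (N := N) hβ1
      (fun F => by
        obtain ⟨Mκ, Rκ, len, hlen, hlen1, h⟩ := hN05 F
        exact exists_entry_of_n05UniformP F N (one_le_ne3NperOfRecord₁₁ F 0 0) Mκ Rκ hβ0 hlen hlen1 h)
      hGm hG C hR
  exact ⟨ℓ₃, fun F => gradConst 4 (c' F), B, hend, hmatch, hrow⟩

end

end Summit.QuantumFields.YangMills.BalabanUVNodes.N16EntrySqueezeJunctionReadingFree
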